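import Summits.RiemannHypothesis.RiemannHypothesis.Theorems.OddSectorOddBartaFloorDefs
import Literature.NumberTheory.LFunctions.WeilThetaPhiMellin
import Literature.NumberTheory.LFunctions.WeilWindowSuzukiProofs
import HarnessLib

/-!
# The truncated window images converge uniformly on the open window
(crux OddBartaFloor, line Sketch, stub tailUniform)

For `a > 0` the window images `T_a = oddThetaImage a` and `T_{a,b} = oddThetaImageTrunc a b` of
`OddSectorOddBartaFloorDefs.lean` satisfy `sup_{|t|<a} |T_{a,b}(t) − T_a(t)| → 0` as `b → ∞`.

* KEY ALGEBRA. Pointwise `R_{a,b} = H_b − H_a = R_a − R_b` (`R_c = −Φ′ − H_c`), so — once the prime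
  layers converge absolutely, the archimedean integrands are integrable (`|t| < a ≤ b`) and the
  polar integrand `(−Φ′)·2 sinh(s/2)` is integrable (`Ioi a = Ioc a b ∪ Ioi b`) — one has
  `T_{a,b}(t) − T_a(t) = −T_b(t)` on the window, and the claim is the uniform smallness of the
  window image `T_b` of a FAR tail.
* With the integrable majorant `F = |Φ′| e^{|·|/2}` (`abs_weilThetaPhiDeriv_le`) and its tails
  `τ_b = ∫_{|s|>b} F → 0`: `|ϖ_b| ≤ τ_b`; `|A_b(t)| ≤ w(1) τ_b` for `|t| + 1 ≤ b` (`R_b` lives on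
  `|s| > b`, where `|t − s| ≥ 1`, and `w = weilArchDensity` is non-increasing,
  `weilArchDensity_antitoneOn`); and for `|t| ≤ a`, `a + N ≤ b` the terms `n < N` of the prime layer
  `P_b(t)` vanish (`|t ± log n| ≤ a + n ≤ b`) while all terms are dominated, uniformly in `|t| ≤ a`,
  by the summable `10176 e^{a} n² e^{−(π/2)e^{−2a} n}`, so `|P_b(t)|` is at most an `N`-tail of a
  convergent `t`-independent series.

Sources: 2001 programme, route `odd-sector-eigenfunction-sign`, results §3 (internal, unpublished);
E. Bombieri, *Remarks on Weil's quadratic functional in the theory of prime numbers* I, Rend. Lincei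
(9) 11 (2000), Thm. 2 (the archimedean density `w`). Everything proved here is folklore real
analysis (the prime-layer majorant is adapted from the sibling file
`OddSectorOddBartaFloorImageMemLp.lean`).
-/

set_option linter.dupNamespace false

noncomputable section

open Set MeasureTheory Filter Complex
open scoped Real Topology ComplexConjugate ArithmeticFunction.vonMangoldt ENNReal

namespace Summit.RiemannHypothesis.RiemannHypothesis.Theorems.OddBartaFloor

open Literature.NumberTheory.LFunctions

/-! ## The odd tail `R_c` -/

/-- `|R_c(x)| ≤ |Φ′(x)|`. [folklore] -/
private theorem tailUniform_abs_tail_le (c x : ℝ) : |oddThetaTail c x| ≤ |weilThetaPhiDeriv x| := by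
  rw [oddThetaTail_def]
  by_cases hx : x ∈ Icc (-c) c
  · rw [weilOddThetaVector_of_mem hx, sub_neg_eq_add, neg_add_cancel, abs_zero]
    exact abs_nonneg _
  · rw [weilOddThetaVector_of_not_mem hx, sub_zero, abs_neg]

/-- Off the closed window, `R_c = −Φ′`. [folklore] -/
private theorem tailUniform_tail_of_not_mem {c s : ℝ} (hs : s ∉ Icc (-c) c) :
    oddThetaTail c s = -weilThetaPhiDeriv s := by
  rw [oddThetaTail_def, weilOddThetaVector_of_not_mem hs, sub_zero]

/-- On the closed window, `R_c = 0`. [folklore] -/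
private theorem tailUniform_tail_of_mem {c s : ℝ} (hs : s ∈ Icc (-c) c) : oddThetaTail c s = 0 := by
  rw [oddThetaTail_def, weilOddThetaVector_of_mem hs, sub_neg_eq_add, neg_add_cancel]

/-- KEY ALGEBRA: `R_{a,b} = R_a − R_b` pointwise, for all `a`, `b`. [folklore] -/
private theorem tailUniform_trunc_eq (a b s : ℝ) :
    oddThetaTailTrunc a b s = oddThetaTail a s - oddThetaTail b s := by
  rw [oddThetaTailTrunc_def, oddThetaTail_def, oddThetaTail_def]
  ring

/-! ## The majorant `F = |Φ′| e^{|·|/2}` and its tails -/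

/-- `F(t) = |Φ′(t)| e^{|t|/2}` is integrable on `ℝ` (super-exponential decay of `Φ′`). [folklore] -/
private theorem tailUniform_integrable_majorant :
    Integrable fun t : ℝ => |weilThetaPhiDeriv t| * rexp (|t| / 2) := by
  have h := integrable_mul_cexp_of_abs_le (f := fun t => |weilThetaPhiDeriv t| * rexp (|t| / 2))
    (by fun_prop) (by positivity : (0 : ℝ) < π / 2) (C := 5088) (c := 1) (fun t => ?_) 0
  · refine h.norm.congr (Eventually.of_forall fun t => ?_)
    simp only [zero_mul, Complex.exp_zero, mul_one, Complex.norm_real, Real.norm_eq_abs]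
    exact abs_of_nonneg (by positivity)
  · rw [abs_of_nonneg (by positivity)]
    calc |weilThetaPhiDeriv t| * rexp (|t| / 2)
        ≤ 5088 * rexp (1 / 2 * |t| - π / 2 * rexp (2 * |t|)) * rexp (|t| / 2) := by
          gcongr
          exact abs_weilThetaPhiDeriv_le t
      _ = 5088 * rexp (1 * |t| - π / 2 * rexp (2 * |t|)) := by
          rw [mul_assoc, ← Real.exp_add]
          congr 2
          ring

/-- `|Φ′| ≤ F`. [folklore] -/
private theorem tailUniform_abs_le_majorant (t : ℝ) :
    |weilThetaPhiDeriv t| ≤ |weilThetaPhiDeriv t| * rexp (|t| / 2) :=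
  le_mul_of_one_le_right (abs_nonneg _) (Real.one_le_exp (by positivity))

/-- The tails `τ_b = ∫_{|t|>b} F` tend to `0`. [folklore] -/
private theorem tailUniform_tendsto_tail :
    Tendsto (fun b : ℝ => ∫ t in (Icc (-b) b)ᶜ, |weilThetaPhiDeriv t| * rexp (|t| / 2))
      atTop (𝓝 0) := by
  have h := tendsto_setIntegral_of_antitone (μ := volume)
    (f := fun t => |weilThetaPhiDeriv t| * rexp (|t| / 2))
    (s := fun b : ℝ => (Icc (-b) b)ᶜ) (fun b => measurableSet_Icc.compl)
    (fun b₁ b₂ h => compl_subset_compl.2 (Icc_subset_Icc (neg_le_neg h) h))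
    ⟨0, tailUniform_integrable_majorant.integrableOn⟩
  have he : ⋂ b : ℝ, (Icc (-b) b)ᶜ = ∅ :=
    eq_empty_of_forall_notMem fun x hx => (mem_iInter.1 hx |x|) ⟨neg_abs_le x, le_abs_self x⟩
  rwa [he, setIntegral_empty] at h

/-! ## The polar weight -/

/-- The polar integrand `(−Φ′(s))·2 sinh(s/2)` is dominated by `F` (`2|sinh(s/2)| ≤ e^{|s|/2}`).
[folklore] -/
private theorem tailUniform_abs_polar_le (s : ℝ) :
    ‖(-weilThetaPhiDeriv s) * (2 * Real.sinh (s / 2))‖ ≤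
      |weilThetaPhiDeriv s| * rexp (|s| / 2) := by
  rw [Real.norm_eq_abs, abs_mul, abs_neg]
  refine mul_le_mul_of_nonneg_left ?_ (abs_nonneg _)
  rw [abs_mul, abs_two, Real.abs_sinh, Real.sinh_eq, abs_div, abs_two]
  linarith [Real.exp_pos (-(|s| / 2))]

/-- The polar integrand is integrable on `ℝ`. [folklore] -/
private theorem tailUniform_integrable_polar :
    Integrable fun s : ℝ => (-weilThetaPhiDeriv s) * (2 * Real.sinh (s / 2)) :=
  tailUniform_integrable_majorant.mono' (by fun_prop)
    (Eventually.of_forall tailUniform_abs_polar_le)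

/-- Polar tail: `|ϖ_b| ≤ τ_b`. [folklore] -/
private theorem tailUniform_abs_polarWeight_le (b : ℝ) :
    |oddThetaPolarWeight b| ≤ ∫ s in (Icc (-b) b)ᶜ, |weilThetaPhiDeriv s| * rexp (|s| / 2) := by
  unfold oddThetaPolarWeight
  calc |∫ s in Ioi b, (-weilThetaPhiDeriv s) * (2 * Real.sinh (s / 2))|
      ≤ ∫ s in Ioi b, |weilThetaPhiDeriv s| * rexp (|s| / 2) :=
        (Real.norm_eq_abs _).symm.trans_le
          (norm_integral_le_of_norm_le tailUniform_integrable_majorant.integrableOn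
            (Eventually.of_forall tailUniform_abs_polar_le))
    _ ≤ _ := setIntegral_mono_set tailUniform_integrable_majorant.integrableOn
        (Eventually.of_forall fun s => by positivity)
        (LE.le.eventuallyLE fun s hs => mem_compl fun h => (mem_Ioi.1 hs).not_ge h.2)

/-! ## The archimedean layer -/

/-- Window separation: for `0 < δ` and `|t| + δ ≤ c`,
`‖R_c(s) w(|t − s|)‖ ≤ w(δ) · (𝟙_{|s|>c} F)(s)` (`R_c` vanishes on `[−c, c]`; off it `|t − s| ≥ δ`,
and `w` is non-increasing on `(0, ∞)`). [folklore] -/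
private theorem tailUniform_kernel_le {c t δ : ℝ} (hδ : 0 < δ) (h : |t| + δ ≤ c) (s : ℝ) :
    ‖oddThetaTail c s * weilArchDensity |t - s|‖ ≤ weilArchDensity δ *
      (Icc (-c) c)ᶜ.indicator (fun s => |weilThetaPhiDeriv s| * rexp (|s| / 2)) s := by
  rw [Real.norm_eq_abs]
  by_cases hs : s ∈ Icc (-c) c
  · rw [tailUniform_tail_of_mem hs, zero_mul, abs_zero, indicator_of_notMem (notMem_compl_iff.2 hs),
      mul_zero]
  have hcs : c < |s| := not_le.1 fun h' => hs (mem_Icc.2 (abs_le.1 h'))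
  have hts : δ ≤ |t - s| := by
    have := abs_sub_abs_le_abs_sub s t
    rw [abs_sub_comm] at this
    linarith
  have hw := weilArchDensity_pos (hδ.trans_le hts)
  rw [tailUniform_tail_of_not_mem hs, indicator_of_mem (show s ∈ (Icc (-c) c)ᶜ from hs), abs_mul,
    abs_neg, abs_of_pos hw, mul_comm]
  exact mul_le_mul (weilArchDensity_antitoneOn (mem_Ioi.2 hδ) (mem_Ioi.2 (hδ.trans_le hts)) hts)
    (tailUniform_abs_le_majorant s) (abs_nonneg _) (weilArchDensity_pos hδ).le

/-- For `|t| < c` the archimedean integrand `s ↦ R_c(s) w(|t − s|)` is integrable. [folklore] -/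
private theorem tailUniform_integrable_kernel {c t : ℝ} (h : |t| < c) :
    Integrable fun s => oddThetaTail c s * weilArchDensity |t - s| := by
  have hw : Measurable weilArchDensity := by
    unfold weilArchDensity
    exact (Real.continuous_exp.comp (continuous_id.div_const 2)).measurable.div
      (continuous_const.mul Real.continuous_sinh).measurable
  refine ((tailUniform_integrable_majorant.indicator measurableSet_Icc.compl).const_mul
    (weilArchDensity (c - |t|))).mono' ?_
    (Eventually.of_forall (tailUniform_kernel_le (sub_pos.2 h) (by linarith)))
  exact ((continuous_weilThetaPhiDeriv.measurable.neg.sub (measurable_weilOddThetaVector c)).mul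
    (hw.comp (by fun_prop))).aestronglyMeasurable

/-- Archimedean tail: for `|t| + 1 ≤ b`, `|A_b(t)| ≤ w(1) τ_b`. [folklore] -/
private theorem tailUniform_abs_archLayer_le {b t : ℝ} (h : |t| + 1 ≤ b) :
    |oddThetaArchLayer b t| ≤
      weilArchDensity 1 * ∫ s in (Icc (-b) b)ᶜ, |weilThetaPhiDeriv s| * rexp (|s| / 2) := by
  unfold oddThetaArchLayer
  rw [← integral_indicator measurableSet_Icc.compl, ← integral_const_mul, ← Real.norm_eq_abs]
  exact norm_integral_le_of_norm_le
    ((tailUniform_integrable_majorant.indicator measurableSet_Icc.compl).const_mul _)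
    (Eventually.of_forall (tailUniform_kernel_le one_pos h))

/-! ## The prime layer: a summable majorant, uniform on `|t| ≤ B` -/

/-- Shifted decay of `Φ′`: for `n ≥ 1`, `B ≥ 0` and `log n − B ≤ |x| ≤ log n + B`,
`|Φ′(x)| ≤ 5088 · n e^{B} e^{−(π/2)e^{−2B} n}`. [folklore] -/
private theorem tailUniform_abs_shift_le {B x : ℝ} {n : ℕ} (hn : 1 ≤ n) (hB : 0 ≤ B)
    (h1 : Real.log n - B ≤ |x|) (h2 : |x| ≤ Real.log n + B) :
    |weilThetaPhiDeriv x| ≤ 5088 * ((n : ℝ) * rexp B * rexp (-(π / 2 * rexp (-(2 * B))) * n)) := by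
  have hn' : (1 : ℝ) ≤ n := by exact_mod_cast hn
  have hL : rexp (Real.log n) = n := Real.exp_log (by linarith)
  have hL0 : 0 ≤ Real.log n := Real.log_nonneg hn'
  have key : (n : ℝ) * rexp B * rexp (-(π / 2 * rexp (-(2 * B))) * n) =
      rexp (Real.log n + B + -(π / 2 * rexp (-(2 * B))) * n) := by
    rw [Real.exp_add, Real.exp_add, hL]
  rw [key]
  refine (abs_weilThetaPhiDeriv_le x).trans (mul_le_mul_of_nonneg_left (Real.exp_le_exp.2 ?_)
    (by norm_num))
  have h3 : rexp (2 * (Real.log n - B)) ≤ rexp (2 * |x|) := Real.exp_le_exp.2 (by linarith)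
  rw [show (2 : ℝ) * (Real.log n - B) = Real.log n + Real.log n + -(2 * B) by ring, Real.exp_add,
    Real.exp_add, hL] at h3
  have h4 : (1 : ℝ) * (n * rexp (-(2 * B))) ≤ n * (n * rexp (-(2 * B))) :=
    mul_le_mul_of_nonneg_right hn' (by positivity)
  have h5 : π / 2 * (n * rexp (-(2 * B))) ≤ π / 2 * rexp (2 * |x|) :=
    mul_le_mul_of_nonneg_left (by linarith) (by positivity)
  linarith

/-- The `n`-th term of the prime layer `P_c(t)` is dominated, uniformly on `|t| ≤ B` and in `c`, by
the summable sequence `10176 e^{B} n² e^{−(π/2)e^{−2B} n}`. [folklore] -/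
private theorem tailUniform_abs_primeTerm_le (c : ℝ) {B t : ℝ} (ht : |t| ≤ B) (n : ℕ) :
    |(Λ n : ℝ) / Real.sqrt n *
        (oddThetaTail c (t - Real.log n) + oddThetaTail c (t + Real.log n))| ≤
      10176 * rexp B * ((n : ℝ) ^ 2 * rexp (-(π / 2 * rexp (-(2 * B))) * n)) := by
  rcases Nat.eq_zero_or_pos n with rfl | hn
  · simp
  have hn' : (1 : ℝ) ≤ n := by exact_mod_cast hn
  have hB : 0 ≤ B := (abs_nonneg t).trans ht
  have hL0 : 0 ≤ Real.log n := Real.log_nonneg hn'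
  obtain ⟨ht1, ht2⟩ := abs_le.1 ht
  have hc0 : 0 ≤ (Λ n : ℝ) / Real.sqrt n :=
    div_nonneg ArithmeticFunction.vonMangoldt_nonneg (Real.sqrt_nonneg _)
  have hc1 : (Λ n : ℝ) / Real.sqrt n ≤ n :=
    (div_le_self ArithmeticFunction.vonMangoldt_nonneg (Real.one_le_sqrt.2 hn')).trans
      (ArithmeticFunction.vonMangoldt_le_log.trans (Real.log_le_self (by linarith)))
  have h1 := tailUniform_abs_shift_le (x := t - Real.log n) hn hB
    (by linarith [neg_le_abs (t - Real.log n)])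
    ((abs_sub _ _).trans (by rw [abs_of_nonneg hL0]; linarith))
  have h2 := tailUniform_abs_shift_le (x := t + Real.log n) hn hB
    (by linarith [le_abs_self (t + Real.log n)])
    ((abs_add_le _ _).trans (by rw [abs_of_nonneg hL0]; linarith))
  rw [abs_mul, abs_of_nonneg hc0]
  calc _ ≤ (n : ℝ) * (5088 * ((n : ℝ) * rexp B * rexp (-(π / 2 * rexp (-(2 * B))) * n)) +
        5088 * ((n : ℝ) * rexp B * rexp (-(π / 2 * rexp (-(2 * B))) * n))) :=
        mul_le_mul hc1 ((abs_add_le _ _).trans (add_le_add ((tailUniform_abs_tail_le _ _).trans h1)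
          ((tailUniform_abs_tail_le _ _).trans h2))) (abs_nonneg _) (Nat.cast_nonneg _)
    _ = _ := by ring

/-- The majorant is summable. [folklore] -/
private theorem tailUniform_summable_majorant (B : ℝ) :
    Summable fun n : ℕ => 10176 * rexp B * ((n : ℝ) ^ 2 * rexp (-(π / 2 * rexp (-(2 * B))) * n)) :=
  (Real.summable_pow_mul_exp_neg_nat_mul 2 (by positivity)).mul_left _

/-- The prime layer `P_c(t)` converges absolutely at every `t`. [folklore] -/
private theorem tailUniform_summable_primeTerm (c t : ℝ) : Summable fun n : ℕ =>
    (Λ n : ℝ) / Real.sqrt n * (oddThetaTail c (t - Real.log n) + oddThetaTail c (t + Real.log n)) :=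
  (tailUniform_summable_majorant |t|).of_norm_bounded fun n =>
    (Real.norm_eq_abs _).trans_le (tailUniform_abs_primeTerm_le c le_rfl n)

/-- Prime tail: for `|t| ≤ a` and `a + N ≤ b` the terms `n < N` of `P_b(t)` vanish
(`|t ± log n| ≤ a + n ≤ b`), so `|P_b(t)|` is at most the `N`-tail of the majorant. [folklore] -/
private theorem tailUniform_abs_primeLayer_le {a b t : ℝ} {N : ℕ} (ht : |t| ≤ a) (hb : a + N ≤ b) :
    |oddThetaPrimeLayer b t| ≤ ∑' k : ℕ, 10176 * rexp a *
      (((k + N : ℕ) : ℝ) ^ 2 * rexp (-(π / 2 * rexp (-(2 * a))) * ((k + N : ℕ) : ℝ))) := by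
  obtain ⟨ht1, ht2⟩ := abs_le.1 ht
  unfold oddThetaPrimeLayer
  rw [← (tailUniform_summable_primeTerm b t).sum_add_tsum_nat_add N, Finset.sum_eq_zero, zero_add]
  · have h := tsum_of_norm_bounded
      ((summable_nat_add_iff N).2 (tailUniform_summable_majorant a)).hasSum
      fun k => (Real.norm_eq_abs _).trans_le (tailUniform_abs_primeTerm_le b ht (k + N))
    rwa [Real.norm_eq_abs] at h
  · intro n hn
    have hn' : (n : ℝ) < N := by exact_mod_cast Finset.mem_range.1 hn
    have hl0 : 0 ≤ Real.log n := Real.log_natCast_nonneg n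
    have hl : Real.log n ≤ n := Real.log_le_self n.cast_nonneg
    rw [tailUniform_tail_of_mem (c := b) (s := t - Real.log n) ⟨by linarith, by linarith⟩,
      tailUniform_tail_of_mem (c := b) (s := t + Real.log n) ⟨by linarith, by linarith⟩,
      add_zero, mul_zero]

/-! ## The identity `T_{a,b} − T_a = −T_b` on the window -/

/-- For `|t| < a ≤ b`: `T_{a,b}(t) − T_a(t) = −T_b(t)` (`R_{a,b} = R_a − R_b`, `tsum_sub`,
`integral_sub`, `Ioi a = Ioc a b ∪ Ioi b`). [folklore] -/
private theorem tailUniform_identity {a b t : ℝ} (hab : a ≤ b) (hta : |t| < a) :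
    oddThetaImageTrunc a b t - oddThetaImage a t = -oddThetaImage b t := by
  have h1 : oddThetaPolarWeightTrunc a b = oddThetaPolarWeight a - oddThetaPolarWeight b := by
    unfold oddThetaPolarWeightTrunc oddThetaPolarWeight
    rw [← Ioc_union_Ioi_eq_Ioi hab, setIntegral_union Ioc_disjoint_Ioi_same measurableSet_Ioi
      tailUniform_integrable_polar.integrableOn tailUniform_integrable_polar.integrableOn]
    ring
  have h2 : oddThetaPrimeLayerTrunc a b t = oddThetaPrimeLayer a t - oddThetaPrimeLayer b t := by
    unfold oddThetaPrimeLayerTrunc oddThetaPrimeLayer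
    rw [← (tailUniform_summable_primeTerm a t).tsum_sub (tailUniform_summable_primeTerm b t)]
    refine tsum_congr fun n => ?_
    rw [tailUniform_trunc_eq, tailUniform_trunc_eq]
    ring
  have h3 : oddThetaArchLayerTrunc a b t = oddThetaArchLayer a t - oddThetaArchLayer b t := by
    unfold oddThetaArchLayerTrunc oddThetaArchLayer
    rw [← integral_sub (tailUniform_integrable_kernel hta)
      (tailUniform_integrable_kernel (hta.trans_le hab))]
    refine integral_congr_ae (Eventually.of_forall fun s => ?_)
    simp only [tailUniform_trunc_eq]
    ring
  rw [oddThetaImageTrunc_def, oddThetaImage_def, oddThetaImage_def, h1, h2, h3]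
  ring

/-! ## Uniform convergence on the window -/

/-- **Stub `tailUniform`**: for `a > 0`, `T_{a,b} → T_a` uniformly on the open window `(−a, a)` as
`b → ∞`: `T_{a,b} − T_a = −T_b` there, and the window image `T_b = 2ϖ_b sinh(·/2) + P_b + A_b` of a
far tail is uniformly small (`|ϖ_b| ≤ τ_b`, `|A_b| ≤ w(1) τ_b`, `|P_b| ≤` a tail of a convergent
`t`-independent series, `τ_b = ∫_{|s|>b} |Φ′| e^{|s|/2} → 0`). [folklore] -/
theorem stub_tailUniform :
    ∀ a : ℝ, 0 < a → ∀ ε : ℝ, 0 < ε → ∃ b₀ : ℝ, ∀ b : ℝ, b₀ ≤ b → ∀ t ∈ Ioo (-a) a,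
      |oddThetaImageTrunc a b t - oddThetaImage a t| ≤ ε := by
  intro a ha ε hε
  have hK := tailUniform_tendsto_tail.const_mul (2 * Real.sinh (a / 2) + weilArchDensity 1)
  rw [mul_zero] at hK
  obtain ⟨b₁, hb₁⟩ := eventually_atTop.1 (hK.eventually_le_const (half_pos hε))
  obtain ⟨N, hN⟩ := eventually_atTop.1 ((tendsto_sum_nat_add fun n : ℕ => 10176 * rexp a *
    ((n : ℝ) ^ 2 * rexp (-(π / 2 * rexp (-(2 * a))) * n))).eventually_le_const (half_pos hε))
  refine ⟨max b₁ (a + N + 1), fun b hb t ht => ?_⟩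
  obtain ⟨hb1, hb2⟩ := max_le_iff.1 hb
  have hta : |t| < a := abs_lt.2 ht
  have hs : |Real.sinh (t / 2)| ≤ Real.sinh (a / 2) := by
    rw [Real.abs_sinh, abs_div, abs_two]
    exact Real.sinh_le_sinh.2 (by linarith)
  have hP := (tailUniform_abs_primeLayer_le hta.le (by linarith : a + N ≤ b)).trans (hN N le_rfl)
  have hW := tailUniform_abs_polarWeight_le b
  have hA := tailUniform_abs_archLayer_le (b := b) (t := t) (by linarith)
  have hτ := hb₁ b hb1
  rw [add_mul] at hτ
  rw [tailUniform_identity (by linarith) hta, abs_neg, oddThetaImage_def]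
  calc |2 * oddThetaPolarWeight b * Real.sinh (t / 2) + oddThetaPrimeLayer b t +
        oddThetaArchLayer b t|
      ≤ |2 * oddThetaPolarWeight b * Real.sinh (t / 2)| + |oddThetaPrimeLayer b t| +
          |oddThetaArchLayer b t| := abs_add_three _ _ _
    _ ≤ 2 * (∫ s in (Icc (-b) b)ᶜ, |weilThetaPhiDeriv s| * rexp (|s| / 2)) * Real.sinh (a / 2) +
          ε / 2 +
          weilArchDensity 1 * ∫ s in (Icc (-b) b)ᶜ, |weilThetaPhiDeriv s| * rexp (|s| / 2) := by
        gcongr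
        rw [abs_mul, abs_mul, abs_two]
        exact mul_le_mul (mul_le_mul_of_nonneg_left hW zero_le_two) hs (abs_nonneg _)
          (mul_nonneg zero_le_two ((abs_nonneg _).trans hW))
    _ ≤ ε := by linarith

end Summit.RiemannHypothesis.RiemannHypothesis.Theorems.OddBartaFloor

end
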